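import Literature.Computability.Cryptography.RegevSamplerMachineSched
import Literature.Computability.Cryptography.RegevSamplerBlockParams
import HarnessLib

/-!
# Regev 2009, Lemma 3.14 in machine form: the per-block bound in the vocabulary of the reduction

Topic `Literature/Computability/Cryptography`, grouping namespace `Regev2009.SamplerRegs`; the capstone of the
machine half of Lemma 3.14. `RegevSamplerMachineSched.exists_negligible_tvDist_machineCirc_le` bounds the output
law of the machine circuit of an abstract level table at an abstract width `t`; here the table is the CLAMPED
table `LevelCode.clamp` at scale `S = D_t²/2` (`Spar`), whose accuracy is a theorem (`accurate_clamp_sched`), and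
the width is the stage width `t = √2 ρ √n/(αq)` of the reduction, so that the bound reads exactly as clause 2 of
the step-family fact `regev2009_lemma_3_14_stepFamily`: under Regev's promise `αq/(√2 ρ) < λ₁(L*)/2` the output
law is within `8·√(weightedFail R (B) ρ k y (αq/(√2ρ)) w) + ν(n)` of `intCoords_* D_{L(B), ρ√n/(αq)}`, with `ν`
negligible and chosen first, and `w = dataLaw …` the law of the machine's `CVP` query data.

What this file does NOT contain (the remainder of Lemma 3.14's step family): the uniform family `S` around the
machine circuit (parsing, slot dispatch, output formatting) and the identification of its kernel with the
machine's output law.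

Everything here is proved; no named fact is introduced.

## References

* O. Regev, *On lattices, learning with errors, random linear codes, and cryptography*, J. ACM 56 (2009),
  art. 34, Lemma 3.14 (statement and proof), Lemma 3.12 (proof) [Regev2009].
* L. Grover, T. Rudolph, *Creating superpositions that correspond to efficiently integrable probability
  distributions*, arXiv:quant-ph/0208112 (2002), eq. (1) [GroverRudolph2002].
-/

noncomputable section

namespace Literature.Computability.Cryptography

namespace Regev2009

namespace SamplerRegs

open Literature.Algebra.EuclideanLattices Literature.Algebra.EuclideanLattices.Regev2009
  Literature.Algebra.EuclideanLattices.Regev2009.QPart Literature.Computability.QuantumComplexity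
  Literature.Computability.QuantumComplexity.GaussianCells Literature.Computability.QuantumComplexity.GroverRudolph
  Literature.Computability.QuantumComplexity.GRWord Literature.Computability.QuantumComplexity.QFTQubits
  Literature.Computability.QuantumComplexity.QFTWord Literature.Computability.QuantumComplexity.TidyBlockFn
  Literature.Computability.QuantumComplexity.QState Literature.Computability.QuantumComplexity.GRMassTable
  Literature.Computability.QuantumComplexity.GRTableMach
  Literature.Computability.Complexity Literature.LinearAlgebra.Matrix.Berkowitz Peikert2009 Finset _root_.Matrix SamplerArith
  SamplerScale SamplerGeom SamplerWords SamplerWordFns SamplerFormats SamplerQuery CVPOracle SamplerClassical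
  SamplerClassical.Layout SamplerSubst SamplerDecode _root_.Computability Module
open Literature.Computability.QuantumComplexity.GRCosineMach (pcode abs_cosA_le_one cosA_update)
open scoped Real

open Classical in
/-- **Regev 2009, Lemma 3.14 — the per-block bound of the machine, in the reduction's vocabulary.** There is a
negligible `ν` such that for every nonsingular instance `B` of dimension `n ≥ 5`, every layout on the register
schedule with precision `m ≥ schedL n e T 0 + 13` (`e ≥ |code B|`, `e ≥ n`, `e ≥ 2`), all positive rationals
`aq` (playing `α(n)q(n)`) and `ρ` (the level radius) with `2^{-T} ≤ √2ρ√n/aq ≤ 2^T` and Regev's promise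
`aq/(√2ρ) < λ₁(L(B)*)/2`, every query format, every `CVP` family `R` and every budget `U ≥ 6(p+ℓ+3)` of the
clamped table machine: the output law of the machine circuit is within
`8·√(weightedFail R B ρ' k y (aq/(√2ρ)) w) + ν(n)` of `intCoords_* D_{L(B), ρ√n/aq}` (`w` the law of the machine's
query data). [cite: Regev2009, Lemma 3.14 (statement and proof), Lemma 3.12 (proof)] [cite: GroverRudolph2002, eq. (1)] -/
theorem exists_negligible_tvDist_machineCirc_le_level :
    ∃ ν : ℕ → ℝ, IsNegligible ν ∧
      ∀ {W : ℕ} (I : LatticeInstance) {Λ : Layout W I.n} (hΛ : Λ.OK) [IsZLattice ℝ I.lattice] [NeZero I.n]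
        (hF : Fits Λ) (_hI : I.IsNonsingular) {T e m : ℕ} (_he : I.encode.length ≤ e) (_hne : I.n ≤ e) (_he2 : 2 ≤ e)
        (_hn5 : 5 ≤ I.n) (_hm : schedL I.n e T 0 + 13 ≤ m)
        (_hR : Λ.ℓR = schedR I.n e T m) (_hL : Λ.ℓ = schedL I.n e T m) (_hY : Λ.ℓY = schedY I.n e) (_hB : Λ.bc = schedB I.n e T)
        (aq ρ : ℚ) (_haq : 0 < aq) (_hρ : 0 < ρ)
        (_htT : tW (aq : ℝ) (ρ : ℝ) I.n ≤ (2 : ℝ) ^ T) (_hTt : (2⁻¹ : ℝ) ^ T ≤ tW (aq : ℝ) (ρ : ℝ) I.n)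
        (_hprom : (aq : ℝ) / (Real.sqrt 2 * ρ) < minNorm (dualLattice I.lattice) / 2)
        (r : ℚ) (k : ℕ) (y : List Bool) (e' : ℚ) (Fq pad : List Bool)
        (_hFq0 : Fq = boolPair (boolPair (stageInput (GapSVPInstance.encode (I, r)) (k + 1) y) (boolPair (encodeNat Λ.ℓR) (encodeNat Λ.bc))) [])
        (_hFq : Fq.length = Λ.Lq) (_huz : (zoneOf Fq ((parOf I, 2 ^ Λ.ℓR), e') pad).length = Λ.L)
        (Rf : UniformQCircuitFamily) (Z : SubZone Λ (Rf.family.ancillas Λ.kq)) (_hZ : ∀ s, Λ.base ≤ (Z.dirt s : ℕ))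
        (U np : ℕ) (hnp : (pcode ((Spar (2 ^ Λ.ℓR) (detA I) aq ρ I.n, (4 * (2 * m + Λ.ℓ + 3), U)), (2 * m + 1, Λ.ℓ))).length ≤ np)
        {E : Fin I.n → (Fin (GRData.B Λ.ℓ np (wlen LevelCode.clamp Λ.ℓ np) (2 * m + 1 + 1)) ↪ Fin W)}
        (_hE : BlocksFit I Λ E (GRData.ws Λ.ℓ np (wlen LevelCode.clamp Λ.ℓ np) (2 * m + 1 + 1)))
        (x' : EuclideanSpace ℝ (Fin I.n)) (_hU : 6 * (4 * (2 * m + Λ.ℓ + 3) + Λ.ℓ + 3) ≤ U)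
        (hroom : Λ.base + I.n * QFTKit.qbsize Λ.ℓR (2 * m + 4) ≤ W),
        ((bornPMF ((machineCirc I hΛ hF Rf Z
                  (GRTableMach.data LevelCode.clamp (Spar (2 ^ Λ.ℓR) (detA I) aq ρ I.n) (4 * (2 * m + Λ.ℓ + 3)) U (2 * m + 1) Λ.ℓ np hnp) E
                  (GRData.eraseList (mach LevelCode.clamp (Spar (2 ^ Λ.ℓR) (detA I) aq ρ I.n) (4 * (2 * m + Λ.ℓ + 3)) U (2 * m + 1) Λ.ℓ np hnp) E)
                  (2 * m + 4) (by omega) hroom).runOn 0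
              (basisState (boxLab E (GRData.ws Λ.ℓ np (wlen LevelCode.clamp Λ.ℓ np) (2 * m + 1 + 1))
                (GRData.init (mach LevelCode.clamp (Spar (2 ^ Λ.ℓR) (detA I) aq ρ I.n) (4 * (2 * m + Λ.ℓ + 3)) U (2 * m + 1) Λ.ℓ np hnp))
                (lab₀ I Λ (2 ^ Λ.ℓR) (tW (aq : ℝ) (ρ : ℝ) I.n) (zoneOf Fq ((parOf I, 2 ^ Λ.ℓR), e') pad) x')
                fun _ => GRData.init (mach LevelCode.clamp (Spar (2 ^ Λ.ℓR) (detA I) aq ρ I.n) (4 * (2 * m + Λ.ℓ + 3)) U (2 * m + 1) Λ.ℓ np hnp) ∘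
                  GRData.ws Λ.ℓ np (wlen LevelCode.clamp Λ.ℓ np) (2 * m + 1 + 1))))).map
            fun z => decZ I (2 ^ Λ.ℓR) (readS (Sblk I hΛ) z)).tvDist
          ((discreteGaussian I.lattice ((ρ : ℝ) * Real.sqrt I.n / aq) 0).map I.intCoords) ≤
          8 * Real.sqrt (weightedFail Rf I r k y ((aq : ℝ) / (Real.sqrt 2 * ρ))
                  (dataLaw (boxSet I.n Λ.ℓ (DT I (2 ^ Λ.ℓR) (tW (aq : ℝ) (ρ : ℝ) I.n)))
                    (fun x => (gaussianFunction 1 x / zBox (boxSet I.n Λ.ℓ (DT I (2 ^ Λ.ℓR) (tW (aq : ℝ) (ρ : ℝ) I.n)))) ^ 2)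
                    (fun _ _ => sq_nonneg _)
                    (sum_boxWeight_eq_one (boxSet_nonempty I.n Λ.ℓ (DT I (2 ^ Λ.ℓR) (tW (aq : ℝ) (ρ : ℝ) I.n))))
                    (cOf I Λ (tW (aq : ℝ) (ρ : ℝ) I.n)))).toReal + ν I.n := by
  obtain ⟨ν, hν, h⟩ := exists_negligible_tvDist_machineCirc_le LevelCode.clamp
  refine ⟨ν, hν, ?_⟩
  intro W I Λ hΛ _ _ hF hI T e m he hne he2 hn5 hm hR hL hY hB aq ρ haq hρ htT hTt hprom r k y e' Fq pad hFq0 hFq huz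
    Rf Z hZ U np hnp E hE x' hU hroom
  have hn : 0 < I.n := lt_of_lt_of_le (by norm_num) hn5
  have haq' : (0 : ℝ) < aq := by exact_mod_cast haq
  have hρ' : (0 : ℝ) < ρ := by exact_mod_cast hρ
  have ht : 0 < tW (aq : ℝ) (ρ : ℝ) I.n := tW_pos haq' hρ' hn
  have hd : Real.sqrt I.n / tW (aq : ℝ) (ρ : ℝ) I.n ≤ minNorm (dualLattice I.lattice) / 2 := promise_tW haq' hρ' hn hprom
  have hT := accurate_clamp_sched I Λ (ℓ := Λ.ℓ) (p := 4 * (2 * m + Λ.ℓ + 3)) haq hρ hn htT hR hL hU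
  have key := h I hΛ hF hI he hne he2 hn5 hm hR hL hY hB ht htT hTt hd r k y e' Fq pad hFq0 hFq huz Rf Z hZ
    (Spar (2 ^ Λ.ℓR) (detA I) aq ρ I.n) U np hnp hE x' hT hroom
  rw [sqrt_div_tW haq' hρ' hn, tW_div_sqrt_two] at key
  exact key

end SamplerRegs

end Regev2009

end Literature.Computability.Cryptography

end
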